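import Mathlib.RepresentationTheory.Coinvariants
import Mathlib.RepresentationTheory.Invariants
import Mathlib.LinearAlgebra.FiniteDimensional.Lemmas
import Mathlib.LinearAlgebra.Finsupp.LinearCombination
import Mathlib.LinearAlgebra.Dimension.Constructions
import HarnessLib

/-!
# An orbit whose Gram functional is constant (`= b`) off the identity and `≠ b` at the identity
# spans the augmentation submodule (the "all-or-nothing" orbit-span lemma)

Module `Summits/Ventures/HodgeKum4/Theorems/KummerFixedLocusOrbitSpan`, namespace
`Summit.Ventures.HodgeKum4.OrbitSpan`.  Everything here is **proved**; no definition, no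
named fact (cell `hodge-kum4`, seat p2: the linear-algebra core of lemma L3 "the `624`
`Γ`-non-invariant `(4,4)`-classes of a `Kum⁴`-type variety lie in the span of the classes of the
`625` fixed fourfolds `W_x`").

## The statement

Let `k` be a field, `G` a finite group, `ρ : G → GL(V)` a representation, `w ∈ V`, and
`φ : V → k` a linear functional with

* `φ(ρ(g) w) = b` for every `g ≠ 1` (one constant `b ∈ k`), and
* `φ(w) ≠ b`.

Write `𝒦(ρ) = span{ρ(g)v − v}` for the augmentation (coinvariants-kernel) submodule
(Mathlib's `Representation.Coinvariants.ker`; for finite `G` in characteristic `0` this is the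
canonical `G`-stable complement of the invariants `V^G`, i.e. the sum of the non-trivial isotypic
components).  If `𝒦(ρ)` is finite-dimensional with `dim 𝒦(ρ) ≤ |G| − 1`, then

* `𝒦(ρ) ⊆ span{ρ(g) w : g ∈ G}` (`coinvariantsKer_le_span_orbit`), and in fact
* `𝒦(ρ)` is the image of the augmentation hyperplane `{a : G → k | Σ a_g = 0}` under the orbit-sum
  map `a ↦ Σ_g a_g ρ(g) w` (`coinvariantsKer_eq_map_orbitSum`), so `dim 𝒦(ρ) = |G| − 1` exactly
  (`finrank_coinvariantsKer_add_one`: "all or nothing");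
* if moreover `|G|` is invertible in `k`: every `v ∈ V` is a `G`-invariant vector plus a
  `k`-combination of the orbit of `w` (`exists_mem_invariants_sub_mem_span_orbit`,
  `invariants_sup_span_orbit_eq_top`).

No commutativity of `G`, no invariance or symmetry of a bilinear form, no positivity, and no roots
of unity in `k` are needed.

## Proof (the Gram matrix `b·J + (s − b)·I`, `s = φ(w)`)

For `a : G → k` with `Σ_g a_g = 0` and every `h ∈ G`,
`φ(ρ(h)⁻¹ Σ_g a_g ρ(g) w) = Σ_g a_g φ(ρ(h⁻¹g) w) = b Σ_g a_g + (φ(w) − b) a_h = (φ(w) − b) a_h`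
(`apply_inv_orbitSum`).  Hence the orbit-sum map is injective on the augmentation hyperplane
(dimension `|G| − 1`), its image lies in `𝒦(ρ)` (as `Σ a_g ρ(g)w = Σ a_g (ρ(g)w − w)`) and in the
span of the orbit, and the dimension hypothesis forces equality.  This is the argument behind
Hassett–Tschinkel's computation for generalized Kummer FOURFOLDS (the `81` classes `Z_τ`,
`τ ∈ A[3]`, with `Z_τ² = 4`, `Z_τ · Z_τ' = 1`, whose Gram matrix `3·I + J` has eigenvalues `84`
and `3` (multiplicity `80`), so that the `Z_τ` span the `81`-dimensional space of canonical middle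
classes: B. Hassett, Y. Tschinkel, *Hodge theory and Lagrangian planes on generalized Kummer
fourfolds*, Prop. 4.3 and Prop. 5.1 with its proof), isolated from the geometry and from the value
of the self-intersection: only `φ(w) ≠ b` matters (for `Kum⁴`: `[W_0]² ≠ [W_0]·[W_x]`).

## Intended use (not formalised here)

`V = H⁸(X(ℂ); ℂ)` for `X` projective of `Kum⁴`-type, `G = Γ ≅ (ℤ/5)⁴ ⊂ Aut(X)` the automorphisms
acting trivially on `H² ⊕ H³`, `w = [W_0]` the class of the maximal fixed component of the
involution `ι` (Floccari, *K3 surfaces associated with varieties of generalized Kummer type*,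
Lemma 4.2 / Prop. 4.6), `φ = ∫_X [W_0] ∪ (·)`; the hypotheses are the intersection numbers
`[W_0] · [W_x] = b` (`x ≠ 0`; `b = 1`) and `[W_0]² ≠ b` (`= 6`), and `dim 𝒦 ≤ 624 = |Γ| − 1`; the conclusion puts the
`624` `Γ`-non-invariant classes in the span of the algebraic classes `[W_x]`.

## Mathlib / tree search

Mathlib: `Representation.Coinvariants.ker`, `Coinvariants.sub_mem_ker`,
`Fintype.linearCombination`, `Fintype.range_linearCombination`,
`LinearMap.finrank_range_add_finrank_ker`, `Submodule.eq_of_le_of_finrank_le`,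
`Representation.averageMap` / `averageMap_invariant` (Reynolds average; used for the consumer
forms `exists_mem_invariants_sub_mem_span_orbit`, `invariants_sup_span_orbit_eq_top`).  Tree:
`Literature.Geometry.Kaehler.isCompl_invariants_coinvariantsKer` (`V = V^G ⊕ 𝒦(ρ)` for completely
reducible `ρ`) is the complement statement consumers combine with this file; nothing in the tree
or in the stockroom (`lean find 'Coinvariants'`, `'orbit.*span'`) proves the present lemma.
-/

namespace Summit.Ventures.HodgeKum4.OrbitSpan

open Representation

variable {k G V : Type*} [Field k] [Group G] [Fintype G] [AddCommGroup V] [Module k V]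

/-- The **orbit-sum map** `a ↦ Σ_g a_g • ρ(g) w` (Mathlib's `Fintype.linearCombination` of the orbit
`g ↦ ρ(g) w`) sends the augmentation hyperplane `{a | Σ_g a_g = 0}` into the augmentation submodule
`𝒦(ρ) = span{ρ(g)v − v}`: `Σ a_g ρ(g)w = Σ a_g (ρ(g)w − w)`. [folklore] -/
theorem orbitSum_mem_coinvariantsKer (ρ : Representation k G V) (w : V) {a : G → k}
    (ha : ∑ g, a g = 0) :
    Fintype.linearCombination k (fun g => ρ g w) a ∈ Coinvariants.ker ρ := by
  have h : Fintype.linearCombination k (fun g => ρ g w) a = ∑ g, a g • (ρ g w - w) := by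
    rw [Fintype.linearCombination_apply]
    simp only [smul_sub, Finset.sum_sub_distrib, ← Finset.sum_smul, ha, zero_smul, sub_zero]
  rw [h]
  exact Submodule.sum_mem _ fun g _ => Submodule.smul_mem _ _ (Coinvariants.sub_mem_ker g w)

/-- **The Gram computation.** If `φ(ρ(g)w) = b` for all `g ≠ 1`, then for every `a : G → k` and
`h ∈ G`: `φ(ρ(h⁻¹)(Σ_g a_g ρ(g) w)) = b·Σ_g a_g + (φ(w) − b)·a_h` — row `h` of the Gram matrix
`b·J + (φ(w) − b)·I` applied to `a` (Hassett–Tschinkel's matrix with `4` on and `1` off the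
diagonal is the case `b = 1`, `φ(w) = 4`). [folklore] -/
theorem apply_inv_orbitSum (ρ : Representation k G V) (w : V) (φ : V →ₗ[k] k) (b : k)
    (hφ : ∀ g : G, g ≠ 1 → φ (ρ g w) = b) (a : G → k) (h : G) :
    φ (ρ h⁻¹ (Fintype.linearCombination k (fun g => ρ g w) a)) =
      b * (∑ g, a g) + (φ w - b) * a h := by
  classical
  rw [Fintype.linearCombination_apply, map_sum, map_sum, Finset.mul_sum]
  have hterm : ∀ g : G, φ (ρ h⁻¹ (a g • ρ g w)) =
      b * a g + (if g = h then (φ w - b) * a h else 0) := by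
    intro g
    rw [map_smul, map_smul, smul_eq_mul, ← Module.End.mul_apply, ← map_mul]
    by_cases hg : g = h
    · subst hg
      rw [inv_mul_cancel, map_one, Module.End.one_apply, if_pos rfl]
      ring
    · have hne : h⁻¹ * g ≠ 1 := by
        intro h1
        apply hg
        have := congrArg (fun x => h * x) h1
        simpa [← mul_assoc] using this
      rw [hφ _ hne, if_neg hg]
      ring
  simp_rw [hterm]
  rw [Finset.sum_add_distrib, Finset.sum_ite_eq' Finset.univ h, if_pos (Finset.mem_univ h)]

/-- **Injectivity on the augmentation hyperplane.** If `φ(ρ(g)w) = b` for `g ≠ 1` and `φ(w) ≠ b`,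
then `Σ_g a_g = 0` and `Σ_g a_g ρ(g) w = 0` force `a = 0` (the Gram matrix `b·J + (φ(w) − b)·I` is
`(φ(w) − b)·I` on the hyperplane `Σ a_g = 0`). [folklore] -/
theorem eq_zero_of_orbitSum_eq_zero (ρ : Representation k G V) (w : V) (φ : V →ₗ[k] k) (b : k)
    (hφ : ∀ g : G, g ≠ 1 → φ (ρ g w) = b) (hw : φ w ≠ b) {a : G → k} (ha : ∑ g, a g = 0)
    (h0 : Fintype.linearCombination k (fun g => ρ g w) a = 0) : a = 0 := by
  funext h
  have key := apply_inv_orbitSum ρ w φ b hφ a h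
  rw [h0, map_zero, map_zero, ha, mul_zero, zero_add] at key
  exact (mul_eq_zero.1 key.symm).resolve_left (sub_ne_zero.2 hw)

/-- The augmentation hyperplane `{a : G → k | Σ_g a_g = 0}`, as the kernel of the sum functional,
has dimension `|G| − 1`. [folklore] -/
theorem finrank_ker_sum_add_one :
    Module.finrank k (LinearMap.ker (Fintype.linearCombination k (fun _ : G => (1 : k)))) + 1 =
      Fintype.card G := by
  set σ : (G → k) →ₗ[k] k := Fintype.linearCombination k (fun _ : G => (1 : k)) with hσ
  classical
  have hsurj : LinearMap.range σ = ⊤ := by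
    rw [LinearMap.range_eq_top]
    intro c
    refine ⟨Pi.single (1 : G) c, ?_⟩
    rw [hσ, Fintype.linearCombination_apply_single, smul_eq_mul, mul_one]
  have hrn := LinearMap.finrank_range_add_finrank_ker σ
  rw [hsurj, finrank_top, Module.finrank_self, Module.finrank_pi, add_comm] at hrn
  exact hrn

/-- **`𝒦(ρ)` is the image of the augmentation hyperplane under the orbit-sum map** — under the Gram
hypotheses `φ(ρ(g)w) = b` (`g ≠ 1`), `φ(w) ≠ b` and the dimension bound `dim 𝒦(ρ) ≤ |G| − 1`:
the image lies in `𝒦(ρ)`, has dimension `|G| − 1` by injectivity, so equals it. [folklore] -/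
theorem coinvariantsKer_eq_map_orbitSum (ρ : Representation k G V) (w : V) (φ : V →ₗ[k] k)
    (b : k) (hφ : ∀ g : G, g ≠ 1 → φ (ρ g w) = b) (hw : φ w ≠ b)
    [Module.Finite k (Coinvariants.ker ρ)]
    (hdim : Module.finrank k (Coinvariants.ker ρ) + 1 ≤ Fintype.card G) :
    Coinvariants.ker ρ =
      (LinearMap.ker (Fintype.linearCombination k (fun _ : G => (1 : k)))).map
        (Fintype.linearCombination k (fun g => ρ g w)) := by
  set T : (G → k) →ₗ[k] V := Fintype.linearCombination k (fun g => ρ g w) with hT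
  set Aug : Submodule k (G → k) :=
    LinearMap.ker (Fintype.linearCombination k (fun _ : G => (1 : k))) with hAug
  have hmemAug : ∀ {a : G → k}, a ∈ Aug ↔ ∑ g, a g = 0 := by
    intro a
    rw [hAug, LinearMap.mem_ker, Fintype.linearCombination_apply]
    simp only [smul_eq_mul, mul_one]
  -- the image lies in `𝒦(ρ)`
  have hle : Aug.map T ≤ Coinvariants.ker ρ := by
    rintro _ ⟨a, ha, rfl⟩
    exact orbitSum_mem_coinvariantsKer ρ w (hmemAug.1 ha)
  -- the orbit-sum map is injective on `Aug`
  have hinj : Function.Injective (T.domRestrict Aug) := by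
    rw [← LinearMap.ker_eq_bot, LinearMap.ker_eq_bot']
    rintro ⟨a, ha⟩ h0
    have h0' : T a = 0 := by simpa using h0
    have := eq_zero_of_orbitSum_eq_zero ρ w φ b hφ hw (hmemAug.1 ha) h0'
    exact Subtype.ext this
  -- dimension count
  have hrank : Module.finrank k (Aug.map T) = Module.finrank k Aug := by
    rw [← LinearMap.range_domRestrict]
    exact LinearMap.finrank_range_of_inj hinj
  have hAugdim : Module.finrank k Aug + 1 = Fintype.card G := finrank_ker_sum_add_one
  symm
  exact Submodule.eq_of_le_of_finrank_le hle (by omega)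

/-- **The orbit-span lemma ("all-or-nothing").**  Let `G` be a finite group acting linearly on `V`
over a field `k`, `w ∈ V`, `φ ∈ V^*` with `φ(ρ(g)w) = b` for all `g ≠ 1` and `φ(w) ≠ b`.  If the
augmentation submodule `𝒦(ρ) = span{ρ(g)v − v}` is finite-dimensional of dimension `≤ |G| − 1`,
then `𝒦(ρ) ⊆ span_k{ρ(g)w : g ∈ G}`.  (Hassett–Tschinkel's `81` classes `Z_τ` spanning the
canonical middle classes of a generalized Kummer fourfold, Prop. 4.3/5.1 of *Hodge theory and
Lagrangian planes on generalized Kummer fourfolds*, is the model; for `Kum⁴`-type it is applied with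
`G = Γ ≅ (ℤ/5)⁴`, `w = [W_0]`, `φ = ∫ [W_0] ∪ ·`.) [folklore] -/
theorem coinvariantsKer_le_span_orbit (ρ : Representation k G V) (w : V) (φ : V →ₗ[k] k)
    (b : k) (hφ : ∀ g : G, g ≠ 1 → φ (ρ g w) = b) (hw : φ w ≠ b)
    [Module.Finite k (Coinvariants.ker ρ)]
    (hdim : Module.finrank k (Coinvariants.ker ρ) + 1 ≤ Fintype.card G) :
    Coinvariants.ker ρ ≤ Submodule.span k (Set.range fun g => ρ g w) := by
  rw [coinvariantsKer_eq_map_orbitSum ρ w φ b hφ hw hdim, ← Fintype.range_linearCombination]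
  exact LinearMap.map_le_range

/-- **All or nothing: the dimension is forced.**  Under the hypotheses of
`coinvariantsKer_le_span_orbit`, `dim 𝒦(ρ) = |G| − 1` exactly (so, for abelian `G` over a field
containing the `|G|`-th roots of unity, EVERY non-trivial character occurs in `V`, each with
multiplicity one as soon as the bound `dim 𝒦(ρ) ≤ |G| − 1` holds). [folklore] -/
theorem finrank_coinvariantsKer_add_one (ρ : Representation k G V) (w : V) (φ : V →ₗ[k] k)
    (b : k) (hφ : ∀ g : G, g ≠ 1 → φ (ρ g w) = b) (hw : φ w ≠ b)
    [Module.Finite k (Coinvariants.ker ρ)]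
    (hdim : Module.finrank k (Coinvariants.ker ρ) + 1 ≤ Fintype.card G) :
    Module.finrank k (Coinvariants.ker ρ) + 1 = Fintype.card G := by
  have heq := coinvariantsKer_eq_map_orbitSum ρ w φ b hφ hw hdim
  have hinj : Function.Injective ((Fintype.linearCombination k (fun g => ρ g w)).domRestrict
      (LinearMap.ker (Fintype.linearCombination k (fun _ : G => (1 : k))))) := by
    rw [← LinearMap.ker_eq_bot, LinearMap.ker_eq_bot']
    rintro ⟨a, ha⟩ h0
    have h0' : Fintype.linearCombination k (fun g => ρ g w) a = 0 := by simpa using h0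
    have ha' : ∑ g, a g = 0 := by
      rw [LinearMap.mem_ker, Fintype.linearCombination_apply] at ha
      simpa only [smul_eq_mul, mul_one] using ha
    exact Subtype.ext (eq_zero_of_orbitSum_eq_zero ρ w φ b hφ hw ha' h0')
  have hrank := LinearMap.finrank_range_of_inj hinj
  rw [LinearMap.range_domRestrict, ← heq] at hrank
  rw [hrank]
  exact finrank_ker_sum_add_one

/-- **Every `ρ(g)v − v` is a `k`-combination of the orbit of `w`** (pointwise form of
`coinvariantsKer_le_span_orbit`, the shape in which the lemma is consumed: a class minus its
translate lies in the span of the classes `ρ(g)w`). [folklore] -/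
theorem sub_mem_span_orbit (ρ : Representation k G V) (w : V) (φ : V →ₗ[k] k)
    (b : k) (hφ : ∀ g : G, g ≠ 1 → φ (ρ g w) = b) (hw : φ w ≠ b)
    [Module.Finite k (Coinvariants.ker ρ)]
    (hdim : Module.finrank k (Coinvariants.ker ρ) + 1 ≤ Fintype.card G) (g : G) (v : V) :
    ρ g v - v ∈ Submodule.span k (Set.range fun g => ρ g w) :=
  coinvariantsKer_le_span_orbit ρ w φ b hφ hw hdim (Coinvariants.sub_mem_ker g v)

/-! ### Combination with averaging (finite `G`, `|G|` invertible in `k`) -/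

/-- For a finite group whose order is invertible in `k`, every vector differs from its average
`|G|⁻¹ Σ_g ρ(g) v` (Mathlib's `Representation.averageMap`, the Reynolds operator) by an element of
the augmentation submodule: `v − avg(v) = |G|⁻¹ Σ_g (v − ρ(g)v) ∈ 𝒦(ρ)`. [folklore] -/
theorem sub_averageMap_mem_coinvariantsKer [Invertible (Fintype.card G : k)]
    (ρ : Representation k G V) (v : V) : v - ρ.averageMap v ∈ Coinvariants.ker ρ := by
  have h : ρ.averageMap v = ⅟(Fintype.card G : k) • ∑ g : G, ρ g v := by
    simp [GroupAlgebra.average, map_sum]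
  have hv : v = ⅟(Fintype.card G : k) • ∑ _g : G, v := by
    rw [Finset.sum_const, Finset.card_univ, ← Nat.cast_smul_eq_nsmul k, smul_smul, invOf_mul_self,
      one_smul]
  rw [h]
  nth_rewrite 1 [hv]
  rw [← smul_sub, ← Finset.sum_sub_distrib]
  refine Submodule.smul_mem _ _ (Submodule.sum_mem _ fun g _ => ?_)
  rw [← neg_sub]
  exact Submodule.neg_mem _ (Coinvariants.sub_mem_ker g v)

/-- **Consumer form.** Under the Gram hypotheses (`φ(ρ(g)w) = b` for `g ≠ 1`, `φ(w) ≠ b`) and the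
dimension bound `dim 𝒦(ρ) ≤ |G| − 1`, with `|G|` invertible in `k`: every `v ∈ V` is a
`G`-INVARIANT vector (its average) plus a `k`-combination of the orbit `ρ(g)w`.  (For `Kum⁴`-type:
every class in `H⁸` is a `Γ`-invariant class plus a combination of the classes `[W_x]`.) [folklore] -/
theorem exists_mem_invariants_sub_mem_span_orbit [Invertible (Fintype.card G : k)]
    (ρ : Representation k G V) (w : V) (φ : V →ₗ[k] k)
    (b : k) (hφ : ∀ g : G, g ≠ 1 → φ (ρ g w) = b) (hw : φ w ≠ b)
    [Module.Finite k (Coinvariants.ker ρ)]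
    (hdim : Module.finrank k (Coinvariants.ker ρ) + 1 ≤ Fintype.card G) (v : V) :
    ∃ v₀ ∈ ρ.invariants, v - v₀ ∈ Submodule.span k (Set.range fun g => ρ g w) :=
  ⟨ρ.averageMap v, ρ.averageMap_invariant v,
    coinvariantsKer_le_span_orbit ρ w φ b hφ hw hdim (sub_averageMap_mem_coinvariantsKer ρ v)⟩

/-- **Consumer form, lattice version**: `V^G + span{ρ(g)w} = V`. [folklore] -/
theorem invariants_sup_span_orbit_eq_top [Invertible (Fintype.card G : k)]
    (ρ : Representation k G V) (w : V) (φ : V →ₗ[k] k)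
    (b : k) (hφ : ∀ g : G, g ≠ 1 → φ (ρ g w) = b) (hw : φ w ≠ b)
    [Module.Finite k (Coinvariants.ker ρ)]
    (hdim : Module.finrank k (Coinvariants.ker ρ) + 1 ≤ Fintype.card G) :
    ρ.invariants ⊔ Submodule.span k (Set.range fun g => ρ g w) = ⊤ := by
  rw [eq_top_iff]
  intro v _
  obtain ⟨v₀, hv₀, hv⟩ := exists_mem_invariants_sub_mem_span_orbit ρ w φ b hφ hw hdim v
  have : v = v₀ + (v - v₀) := by abel
  rw [this]
  exact Submodule.add_mem_sup hv₀ hv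

end Summit.Ventures.HodgeKum4.OrbitSpan
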